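import Summits.RiemannHypothesis.RiemannHypothesis.Theorems.SuzukiThetaFlowChain
import Literature.NumberTheory.LFunctions.WeilOddGroundState

/-!
# SuzukiThetaFlowDecay — the θ-FLOW DECAY LAW (statement) and its proved corollaries (column DBR; RH-FREE)

LINE 1 — LABEL: RH-FREE definition (`ThetaFlowDecay`, a PROOF-OF-DATA rung leaf of LADDER-RH column 6 DBR, theory
round 2) + RH-FREE corollaries proved here; bears_on: B-P(P2) (Suzuki's clean windows) via the cross-column transfer
W-C ⇒ B-P.  WHAT THIS IS NOT: not a proof of the law (that is route `Theses/ThetaFlowDecay.lean`: `FlowPairingAll`,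
`OutputsCoercive`), not a statement about zeros, not evidence for or against RH.  The law is unconditional in the sense
that it holds (if true) for EVERY window half-width `t > 0` whatever the sign of Weil's ground energy `ε(t)`; its
clean-window consequences are unconditional exactly on the windows where Weil positivity is a theorem (today `t ≤ 1`,
`WeilFormatCData.A1.weilPositivityOn_one`), and `∀ t` they are Weil's criterion re-indexed (RH) — declared, not claimed.

THE LAW.  For `t > 0`, `1 < θ₀ ≤ θ₁` and `f ∈ L²(−t,t)`:

  `‖𝖪_{θ₁}[t] f‖² ≤ exp(−2·ε(t)·(θ₁ − θ₀)) · ‖𝖪_{θ₀}[t] f‖²`,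

`𝖪_θ[t] = winOp (limKernel θ) t` Suzuki's truncated Hankel-type operator of [Su20] (1.4) on the window `(−t,t)`,
`ε(t) = weilGroundEnergy t` the infimum of `Re Q(g)/‖g‖²` over smooth `g` supported in `[−t,t]` (Bombieri 2000 §4,
Yoshida 1992).  MECHANISM (route): the θ-flow identity `d/dθ ‖𝖪_θ[t]f‖² = −2 Re Q(g_θ)`, `g_θ = 𝟙_{(−t,t)}𝖪_θ[t]f`
(`ThetaFlowIdentity`, ⟸ `FlowPairing`, PROVED reduction `thetaFlowIdentity_of_flowPairing`), the coercive extension of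
`ε(t)‖g‖² ≤ Re Q(g)` from smooth tests to the window outputs (`OutputsCoercive`; tree tools: Connes–Consani's form domain
`ConnesConsani2023.formDomain`, `YoshidaCompletedForm.weilGroundEnergy_le_weilFinitePrimeQuadratic`), and Grönwall.
DATA (certified, RH-free; HOME DATA.md §ET1e, kit j254585): on the grid θ ∈ {2,…,24} × t ∈ {0.025,…,1.3} the window norms
are θ-antitone at all 81 certified pairs (Q-T1), every certified pair slope `s(θ₀,θ₁;t) = −Δlog σ₁²/(2Δθ)` exceeds the
certified `ε(t)` (Q-C6, 18/18), and `σ₁(θ,t) ≤ e^{−θ ε(t)}` throughout (Q-C6′).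

COROLLARIES (proved below): `ThetaFlowDecay → WeilWindowAntitone` (under `WeilPositivityOn t`, `ε(t) ≥ 0` by
`weilGroundEnergy_nonneg_iff_holds`, so the factor is `≤ 1`); hence `NormSqAntitone t` for every `0 < t ≤ 1`
UNCONDITIONALLY (`weilPositivityOn_one`), and `RungTwelveOne ⟸ ThetaFlowDecay + Anchor 12 1` (`rung_of'`).

References: [Su20] M. Suzuki, ASPM 84 (2020) = arXiv:1907.07302, (1.4), Thm 1.9; A. Weil (1952); E. Bombieri, Rend.
Lincei (9) 11 (2000) §4; H. Yoshida, ASPM 21 (1992); A. Connes, C. Consani, Enseign. Math. 69 (2023) §2.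
-/

noncomputable section

-- D-0017: `Summit.<S>.<S>.…` is the designed namespace of a single-problem summit.
set_option linter.dupNamespace false

open Complex MeasureTheory Set

namespace Summit.RiemannHypothesis.RiemannHypothesis.Theorems.SuzukiThetaFlow

open Literature.NumberTheory.LFunctions

/-- RH-FREE (definition; theory round-2 rung leaf, PROOF-OF-DATA). **THE θ-FLOW DECAY LAW**: for every window
half-width `t > 0`, every `1 < θ₀ ≤ θ₁` and every `f ∈ L²(−t,t)`,
`‖𝖪_{θ₁}[t]f‖² ≤ exp(−2 ε(t) (θ₁ − θ₀)) ‖𝖪_{θ₀}[t]f‖²`, `ε(t) = weilGroundEnergy t`.  No sign of `ε(t)` is asserted. -/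
def ThetaFlowDecay : Prop :=
  ∀ t : ℝ, 0 < t → ∀ θ₀ θ₁ : ℝ, 1 < θ₀ → θ₀ ≤ θ₁ → ∀ f : ℝ → ℝ, MemLp f 2 (winMeasure t) →
    winNormSq (limKernel θ₁) t f ≤
      Real.exp (-2 * weilGroundEnergy t * (θ₁ - θ₀)) * winNormSq (limKernel θ₀) t f

/-- RH-FREE · window norms are non-negative (an integral of squares). -/
theorem winNormSq_nonneg (K : ℝ → ℝ) (t : ℝ) (f : ℝ → ℝ) : 0 ≤ winNormSq K t f :=
  setIntegral_nonneg measurableSet_Ioo fun _ _ => sq_nonneg _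

/-- RH-FREE · **decay law + Weil positivity on the window ⇒ (T1) on that window** (`t > 0`): `ε(t) ≥ 0`
(`weilGroundEnergy_nonneg_iff_holds`) makes the decay factor `≤ 1`. -/
theorem normSqAntitone_of_decay (hD : ThetaFlowDecay) {t : ℝ} (ht : 0 < t) (hW : WeilPositivityOn t) :
    NormSqAntitone t := by
  intro θ₀ θ₁ hθ₀ hθ₀₁ f hf
  have hε : 0 ≤ weilGroundEnergy t := (weilGroundEnergy_nonneg_iff_holds ht).2 hW
  have hfac : Real.exp (-2 * weilGroundEnergy t * (θ₁ - θ₀)) ≤ 1 := by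
    apply Real.exp_le_one_iff.2
    have : 0 ≤ θ₁ - θ₀ := sub_nonneg.2 hθ₀₁
    nlinarith
  calc winNormSq (limKernel θ₁) t f
      ≤ Real.exp (-2 * weilGroundEnergy t * (θ₁ - θ₀)) * winNormSq (limKernel θ₀) t f :=
        hD t ht θ₀ θ₁ hθ₀ hθ₀₁ f hf
    _ ≤ 1 * winNormSq (limKernel θ₀) t f :=
        mul_le_mul_of_nonneg_right hfac (winNormSq_nonneg _ _ _)
    _ = winNormSq (limKernel θ₀) t f := one_mul _

/-- RH-FREE · on the degenerate window `t = 0` every window norm vanishes. -/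
theorem winNormSq_zero_window (K : ℝ → ℝ) (f : ℝ → ℝ) : winNormSq K 0 f = 0 := by
  unfold winNormSq
  rw [neg_zero, Ioo_self, Measure.restrict_empty, integral_zero_measure]

/-- RH-FREE · **decay law ⇒ (T1) `WeilWindowAntitone`** (the transfer column 2 ⇒ column 6 on every window where Weil
positivity holds; the window `t = 0` is degenerate). -/
theorem weilWindowAntitone_of_decay (hD : ThetaFlowDecay) : WeilWindowAntitone := by
  intro t ht hW
  rcases ht.eq_or_lt with h0 | hpos
  · subst h0
    intro _ _ _ _ _ _
    rw [winNormSq_zero_window, winNormSq_zero_window]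
  · exact normSqAntitone_of_decay hD hpos hW

/-- RH-FREE · **UNCONDITIONAL (T1) on the certified Weil windows**: the decay law alone makes `θ ↦ ‖𝖪_θ[t]f‖²`
non-increasing on `(1,∞)` for every `0 < t ≤ 1`, the Weil input being the TREE theorem
`WeilFormatCData.A1.weilPositivityOn_one` (monotone down to `t ≤ 1`). -/
theorem normSqAntitone_of_decay_le_one (hD : ThetaFlowDecay) {t : ℝ} (ht : 0 < t) (ht1 : t ≤ 1) :
    NormSqAntitone t :=
  normSqAntitone_of_decay hD ht (WeilPositivityOn.mono ht1
    Summit.RiemannHypothesis.RiemannHypothesis.Theorems.WeilFormatCData.A1.weilPositivityOn_one)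

/-- RH-FREE · the idea-2 rung from the decay law and one anchor (`rung_of'`). -/
theorem rungTwelveOne_of_decay (hD : ThetaFlowDecay) (hanchor : Anchor 12 1) : RungTwelveOne :=
  rung_of' (weilWindowAntitone_of_decay hD) hanchor

end Summit.RiemannHypothesis.RiemannHypothesis.Theorems.SuzukiThetaFlow

end
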